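import Mathlib
import Summits.Ventures.PercRepro2.MixChordWitness

/-!
# The «for every root edge» row on the narrowed domain (blind cell PercRepro2, night-1 g19;
NIGHT1-G19.md §8)

The thirteen kit failures of the «for every root edge» form of (MIX-CHORD) all sit on vectors
that carry a witness-class root edge (a bridge or an edge from `a₃` to a root).  The row of record
in its strongest census-true shape is therefore the «for every root edge» row assumed only at the
vectors WITHOUT a witness-class root edge (`MixChordNoWitness_all`); it implies the existential
narrowed row and hence the crux (**`HCov_all_of_mixChordNoWitness_all`**).

Own code; standard axioms.
-/

namespace Summit.Ventures.PercRepro2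

open UnionCluster CovForm

namespace Mix

open scoped Classical

section NoWitnessAll

variable (R : Type*) [Field R] [LinearOrder R] [IsStrictOrderedRing R]

/-- (MIX-CHORD) along EVERY root edge, assumed only at the vectors with no root edge of a witness
class. -/
def MixChordNoWitness_all : Prop :=
  ∀ (V E : Type) [Fintype V] [DecidableEq V] [Fintype E] [DecidableEq E]
    (ends : E → Sym2 V) (p : E → R), IsProbVec p →
    ∀ o a₁ a₂ a₃ b : V, a₁ ≠ a₂ → a₁ ≠ a₃ → a₂ ≠ a₃ → o ≠ a₁ → o ≠ a₂ → o ≠ a₃ → o ≠ b →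
      b ≠ a₁ → b ≠ a₂ → b ≠ a₃ →
      (∀ e ∈ Chord.rootEdges p ends a₁ a₂, ¬ WitnessClass p ends a₁ a₂ a₃ e) →
      MixChord p ends o a₁ a₂ a₃ b

/-- **The crux from the «for every root edge» row on the narrowed domain.** -/
theorem HCov_all_of_mixChordNoWitness_all (h : MixChordNoWitness_all R) : HCov_all R :=
  HCov_all_of_mixChordExistsNarrowed_all R fun V E _ _ _ _ ends p hp o a₁ a₂ a₃ b h12 h13 h23 ho1
    ho2 ho3 hob hb1 hb2 hb3 hw =>
      mixChordExists_of_mixChord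
        (h V E ends p hp o a₁ a₂ a₃ b h12 h13 h23 ho1 ho2 ho3 hob hb1 hb2 hb3 hw)

end NoWitnessAll

end Mix

end Summit.Ventures.PercRepro2
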